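import Literature.Probability.LatticeModels.AnisotropicPlaneRotatorTorusBoxCriterion
import Literature.Probability.LatticeModels.LayeredPlaneRotatorStackStiffnessTransition
import Literature.Probability.LatticeModels.LayeredPlaneRotatorSusceptibilityDichotomy
import Literature.Probability.LatticeModels.LayeredPlaneRotatorBoxDecoupling
import Literature.Probability.LatticeModels.PlaneRotatorShellDecay
import Literature.Probability.LatticeModels.PlaneRotatorPeriodicSusceptibility
import Literature.Probability.LatticeModels.PlaneRotatorFreeTwoPointInvariance
import HarnessLib

/-!
# The interlayer ordering criterion `J⊥ · χ₂(T) < T` for the layered plane rotator, as a one-sided theorem: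
# across-layer decay on the torus and in infinite volume, no long-range order, no c-axis helicity modulus

Topic `Literature/Probability/LatticeModels`. Sources: E. H. Lieb, *A refinement of Simon's correlation inequality*,
Comm. Math. Phys. **77** (1980) 127–135 [Lieb1980], eq. (23) (in the tree: `PlaneRotator.liebRivasseauInequality_holds`,
V. Rivasseau, ibid. 145 [Rivasseau1980]); M. Aizenman, B. Simon, *Local Ward identities and the decay of correlations in
ferromagnets*, Comm. Math. Phys. **77** (1980) 137 [AizenmanSimon1980LocalWard], Thm 3.1–3.2 and Remark 4 (decay from
the iteration of a local inequality; for `N = 2`, `u(K) = I₁(K)/I₀(K) ≤ K/2`); B. Simon, ibid. 111 [Simon1980CMP], Thm 1.3;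
the layered couplings `(J, J, εJ)` of L. L. Liu, H. E. Stanley, Phys. Rev. Lett. **29** (1972) 927 [LiuStanley1972], whose
p. 272 discussion of `T_c(ε)` is the modelling context (the interlayer "mean-field"/RPA estimate
`z⊥ J⊥ χ₂(T_c) ≈ T_c`); M. E. Fisher, M. N. Barber, D. Jasnow, Phys. Rev. A **8** (1973) 1111 [FisherBarberJasnow1973] §II
(helicity modulus).

## What is proved

Write `K∥ = βJ∥`, `K⊥ = βJ⊥`, and let `X` be ANY ceiling on the periodic susceptibility of ONE layer,
`∑_v ⟨cos(θ_w − θ_v)⟩^{(ℤ/Lℤ)²}_{K∥,L} ≤ X` (every base point `w`; by translation invariance the base point `0` suffices,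
`torusXY_sum_expectJ_cosDiff_eq_zero_base`). Put `A := K⊥ · X`. For the layered XY model on the torus `(ℤ/Lℤ)³`
(mod-1's objects `AnisotropicRotator.corr`, `plateau` at the coupling vector `layeredCoupling K∥ K⊥ = (K∥, K∥, K⊥)`;
the stack stiffness `torusXYDirStiffness` of `LayeredPlaneRotatorStackStiffness.lean`):

* **§2 `torusXY_expectJ_cosDiff_layered_le_pow_interlayer`** (the engine, every `L ≥ 3`, no smallness needed):
  `⟨cos(θ_a − θ_c)⟩_{(K∥,K∥,K⊥),L} ≤ A^{d₂(a,c)}`, `d₂(a, c) = |valMinAbs (a − c)₂|` the cyclic LAYER distance. Proof: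
  Lieb's separating inequality with the inside system of `x` = the bonds TOUCHING the layer of `x` (tree Simon
  iteration `twoPoint_le_pow_of_shell_rowSum_le`, regions = a layer and its two neighbours, shells = the two
  neighbours); the shell row sum is mod-1's leaf bound `twoPoint_add_leaf_le` — every rotator of an adjacent layer hangs
  on ONE vertical bond, Aizenman–Simon's local Ward inequality gives `u(K⊥) ≤ K⊥/2` per orientation, two vertical
  neighbours per layer site — times the in-plane two-point function of the layer ALONE, which the Griffiths–Ginibre
  embedding `twoPoint_le_of_injOn` (layer → `(ℤ/Lℤ)²`, drop the third coordinate) bounds by the two-dimensional torus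
  model: row sum `≤ K⊥ · X`.
* **§4 on the typed order objects** (`AnisotropicRotator` namespace): `corr_layered_le_pow_interlayer` (the same for
  `corr`); for `A < 1`: `sum_corr_layered_le_interlayer` (`∑_y corr x y ≤ L²(1 + A)/(1 − A)` — one layer's worth, not the
  volume), **`plateau_layered_le_interlayer`** (`plateau_L ≤ (1 + A)/((1 − A)·L)`), the headline forms
  `plateau_layered_le_two_div` (`≤ 2L²/(1 − A)`, `≤ 2/((1 − A)·L)`), `tendsto_plateau_layered_of_interlayer_lt_one`
  (`plateau_{L+1} → 0` when the layer susceptibility is bounded by `X` for all large `L`); the c-axis helicity modulus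
  **`abs_torusXYDirStiffness_cAxis_le_interlayer`** (`|βΥ^{3D}_{L,e₃}| ≤ 4K⊥²·L³·A^{2(⌊L/2⌋−1)}`, `L ≥ 4`, `A ≤ 1`),
  **`tendsto_torusXYDirStiffness_cAxis_of_interlayer_lt_one`** (`βΥ^{3D}_{L+1,e₃} → 0`),
  `layeredStiffnessLiminf_cAxis_eq_zero_of_interlayer_lt_one` (`Υ^{3D}_∞(K∥, K⊥, e₃) = 0`),
  `ofReal_le_layeredStiffnessCriticalCoupling_cAxis_of_interlayer` (the c-axis stiffness transition coupling
  `K_Υ^{3D}(Δ, e₃)` lies above every `c` with `Δ·K·X(K) < 1` on `[0, c)`); the COMPUTABLE form from ONE terminating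
  two-dimensional box `S_R(K∥) ≤ m < 1` (`X = X_R(m) := ∑_{z ∈ ℤ²} m^{⌊‖z‖_∞/R⌋}`, tree
  `sum_torusXY_expectJ_cosDiff_le_tsum`): `corr_layered_le_pow_interlayer_box`, `plateau_layered_le_interlayer_box`,
  `layeredStiffnessLiminf_cAxis_eq_zero_of_interlayer_box` — an EXPLICIT weak-interlayer window `K⊥ < 1/X_R(m)`; and the
  temperature form **`plateau_layered_le_of_interlayer_temperature`**: `J∥, J⊥ ≥ 0`, `T > 0`, `J⊥ · χ < T` ⇒
  `plateau_L(J∥/T, J∥/T, J⊥/T) ≤ (T + J⊥χ)/((T − J⊥χ)·L)`.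
* **§5 free boundary conditions, infinite volume** (`PlaneRotator` namespace): `sum_twoPoint_inPlane_le_tsum_infTwoPoint`
  (the in-plane system of a layer of any finite `Λ ⊂ ℤ³` has susceptibility `≤ χ₂(βJ∥) := ∑_{w ∈ ℤ²} G^{free,∞}_{βJ∥}(0,w)`),
  `twoPoint_layered_le_pow_interlayer_tsum` (mod-1's `twoPoint_layered_le_pow_interlayer'` with that input), and
  **`infTwoPointLayered_le_pow_interlayer`**: `G^{3D,free,∞}_{β;J∥,J⊥}(x, y) ≤ (βJ⊥ · χ₂(βJ∥))^{|x₂ − y₂|}`.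
* §1, §3: plumbing (cyclic layer distance and adjacency on the torus; `∑_{m ∈ ℤ} A^{|m|} = (1 + A)/(1 − A)`, the layer
  sum on `ℤ/L`, slices of `(ℤ/L)³`, `(n + 1)^k rⁿ → 0`).

## Reading (cell `pub/hubbard-tc`, MO-S3, §2.4 G2 «2D → 3D ordering», ASSUMPTIONS key I1; classical comparison model)

The interlayer mean-field (RPA) ordering criterion `J⊥ · χ₂(J∥/T) < T` — with the O(2) susceptibility per component
`(β/2)∑⟨cos⟩` and `z⊥ = 2` neighbouring layers this is exactly `z⊥ J⊥ (β/2) ∑_v⟨cos(θ_0 − θ_v)⟩ < 1` — read ONE-SIDEDLY,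
certifies the ABSENCE of three-dimensional order in the layered rotator: across-layer correlations
`≤ (J⊥χ₂/T)^{|Δℓ|}` uniformly in the volume (torus and free), long-range-order parameter `≤ 2/((1 − J⊥χ₂/T)·L)`, c-axis
helicity modulus `→ 0`. So the onset temperatures of 3D long-range order and of c-axis (interlayer) phase stiffness are
at most `T_×(J∥, J⊥) := inf{T : J⊥ · χ₂(J∥/T) < T}`: the RPA interlayer temperature is an UPPER BOUND, not an
estimate. Since `χ₂(K∥) < ∞` exactly for `K∥ < K_χ(2)` (tree `summable_infTwoPoint_iff_ofReal_lt`), `T_× > T_χ^{2D}(J∥)`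
for every `J⊥ > 0`; the qualitative limit `J⊥ → 0` is the tree's `summable_layered_of_summable_layer` /
`tendsto_layeredSusceptibilityCriticalCoupling_zero` and is not re-derived here.

NOT CLAIMED. (1) No bound on the stack's susceptibility `χ^{3D}` and no in-plane decay follow from this criterion:
two sites of the SAME layer are not separated by the neighbouring layers, so Lieb–Rivasseau gives nothing for them (the
bound `χ^{3D} ≤ χ₂/(1 − 2βJ⊥χ₂)` would need the Brydges–Fröhlich–Spencer random-walk/skeleton inequality, which is not
in the tree); accordingly nothing is said about `K_χ^{3D}` or the in-plane stack stiffness. (2) `χ₂` of an effective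
superconducting layer is a modelling input (key K5), never certified: no number of record, no kelvin, no `T_c`.
(3) The constant uses `u(K⊥) ≤ K⊥/2`; the sharper `2u(K⊥)·X` is not tracked.
-/

noncomputable section

open MeasureTheory Finset Filter
open scoped BigOperators Topology

namespace Literature.Probability.LatticeModels

open PlaneRotator AnisotropicRotator

variable {L : ℕ} [NeZero L]

/-! ## §1 Layers of the torus `(ℤ/Lℤ)³`: cyclic layer distance and adjacency -/

section Layers

omit [NeZero L] in
/-- The cyclic layer distance of a site to itself is `0`. [cite: FriedliVelenik2017, §3.1 (periodic distance) — plumbing] -/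
theorem natAbs_valMinAbs_coord_self {d : ℕ} (x : TorusSite d L) (i : Fin d) :
    ((x - x) i).valMinAbs.natAbs = 0 := by
  simp

omit [NeZero L] in
/-- Zero cyclic layer distance means the same layer: `|valMinAbs (y − x)₂| = 0 ↔ y₂ = x₂`.
[cite: FriedliVelenik2017, §3.1 (periodic distance) — plumbing] -/
theorem natAbs_valMinAbs_coord_eq_zero_iff {d : ℕ} (x y : TorusSite d L) (i : Fin d) :
    ((y - x) i).valMinAbs.natAbs = 0 ↔ y i = x i := by
  rw [Int.natAbs_eq_zero, ZMod.valMinAbs_eq_zero, Pi.sub_apply, sub_eq_zero]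

omit [NeZero L] in
/-- **Adjacent sites are in the same or in adjacent layers**: along a bond `(y, y + eᵢ)` every cyclic coordinate
distance to a fixed site changes by at most one, in both directions. [cite: FriedliVelenik2017, §3.1 (periodic distance) — plumbing] -/
theorem natAbs_valMinAbs_coord_adj {d : ℕ} (hL : 2 ≤ L) (x : TorusSite d L) {y z : TorusSite d L} {i : Fin d}
    (h : y + Pi.single i 1 = z ∨ z + Pi.single i 1 = y) (j : Fin d) :
    ((y - x) j).valMinAbs.natAbs ≤ ((z - x) j).valMinAbs.natAbs + 1 ∧
      ((z - x) j).valMinAbs.natAbs ≤ ((y - x) j).valMinAbs.natAbs + 1 := by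
  rcases h with h | h
  · subst h
    exact ⟨(natAbs_valMinAbs_coord_add_single_le hL x y i j).2, (natAbs_valMinAbs_coord_add_single_le hL x y i j).1⟩
  · subst h
    exact ⟨(natAbs_valMinAbs_coord_add_single_le hL x z i j).1, (natAbs_valMinAbs_coord_add_single_le hL x z i j).2⟩

omit [NeZero L] in
/-- **An in-plane bond keeps the layer, a vertical bond changes it**: if `z = y + eᵢ` on `(ℤ/Lℤ)³` (`L ≥ 2`) then
`z₂ = y₂ ↔ i ≠ 2`. [cite: LiuStanley1972, p. 272 (layers (J, J, εJ)) — plumbing] -/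
theorem apply_two_add_single_eq_iff (hL : 2 ≤ L) (y : TorusSite 3 L) (i : Fin 3) :
    (y + Pi.single i (1 : ZMod L) : TorusSite 3 L) 2 = y 2 ↔ i ≠ 2 := by
  haveI : Fact (1 < L) := ⟨by omega⟩
  rw [Pi.add_apply, add_eq_left]
  constructor
  · intro h hi
    subst hi
    rw [Pi.single_eq_same] at h
    exact one_ne_zero h
  · intro hi
    rw [Pi.single_eq_of_ne (Ne.symm hi)]

omit [NeZero L] in
/-- The first two coordinates of `y + eᵢ` for an in-plane direction `i = castSucc i'`: the layer projection
`v ↦ (v₀, v₁)` maps the bond `(y, y + eᵢ)` of `(ℤ/Lℤ)³` to the bond `(πy, πy + e_{i'})` of `(ℤ/Lℤ)²`.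
[cite: LiuStanley1972, p. 272 (layers (J, J, εJ)) — plumbing] -/
theorem proj_add_single_castSucc (y : TorusSite 3 L) (i' : Fin 2) :
    (fun j : Fin 2 => (y + Pi.single (Fin.castSucc i') (1 : ZMod L) : TorusSite 3 L) (Fin.castSucc j)) =
      (fun j : Fin 2 => y (Fin.castSucc j)) + Pi.single i' (1 : ZMod L) := by
  funext j
  simp only [Pi.add_apply]
  congr 1
  by_cases hj : j = i'
  · subst hj; simp
  · rw [Pi.single_eq_of_ne hj, Pi.single_eq_of_ne]
    exact fun h => hj (Fin.castSucc_injective _ h)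

omit [NeZero L] in
/-- A vertical bond returns to the layer under the vertical foot map: if `y₂ = x₂`, `z₂ ≠ x₂` and `(y, z)` is a
bond, then replacing the third coordinate of `z` by `x₂` gives back `y`. [cite: LiuStanley1972, p. 272 (layers (J, J, εJ)) — plumbing] -/
theorem update_two_eq_of_adj (hL : 2 ≤ L) {x y z : TorusSite 3 L} (hy : y 2 = x 2) (hz : z 2 ≠ x 2) {i : Fin 3}
    (h : y + Pi.single i 1 = z ∨ z + Pi.single i 1 = y) : Function.update z 2 (x 2) = y := by
  -- the bond is vertical
  have hi : i = 2 := by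
    by_contra hi
    rcases h with h | h
    · have := (apply_two_add_single_eq_iff hL y i).2 hi
      rw [h] at this
      exact hz (this.trans hy)
    · have := (apply_two_add_single_eq_iff hL z i).2 hi
      rw [h] at this
      exact hz (this.symm.trans hy)
  subst hi
  funext j
  by_cases hj : j = 2
  · subst hj
    rw [Function.update_self]
    exact hy.symm
  · rw [Function.update_of_ne hj]
    rcases h with h | h
    · rw [← h, Pi.add_apply, Pi.single_eq_of_ne hj, add_zero]
    · have := congr_fun h j
      rw [Pi.add_apply, Pi.single_eq_of_ne hj, add_zero] at this
      exact this

end Layers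

/-! ## §2 Across-layer decay on the torus from the layer's periodic susceptibility -/

section Criterion

variable [MeasurableSpace Circle] [BorelSpace Circle]

/-- **The interlayer criterion on the torus (across-layer decay at every volume).** Let `K∥, K⊥ ≥ 0`, `L ≥ 3`, and let
`X` bound the periodic susceptibility of ONE layer at coupling `K∥` from every base point:
`∑_v ⟨cos(θ_w − θ_v)⟩_{K∥,L}^{(ℤ/Lℤ)²} ≤ X` for all `w`. Then for all sites `a, c` of `(ℤ/Lℤ)³`

  `⟨cos(θ_a − θ_c)⟩_{(K∥,K∥,K⊥),L} ≤ (K⊥ · X)^{d₂(a,c)}`,  `d₂(a, c) = |valMinAbs (a − c)₂|` the cyclic layer distance.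

Proof: Lieb's separating inequality (23) (tree `liebRivasseauInequality_holds`, through the Simon iteration
`twoPoint_le_pow_of_shell_rowSum_le`) with the inside system of a site `x` = the bonds TOUCHING the layer of `x` (its
in-plane bonds and the vertical bonds to the two adjacent layers, which form the shell); the shell row sum is the leaf
bound `twoPoint_add_leaf_le` (the adjacent-layer rotators hang on single vertical bonds: Aizenman–Simon's local Ward
inequality `u(K⊥) ≤ K⊥/2` at each of the `2` vertical neighbours of every layer site) times the in-plane two-point
function of the layer ALONE, which is dominated by (indeed equal to) the two-dimensional torus model (Griffiths–Ginibre,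
`twoPoint_le_of_injOn` along the layer projection); summing over the layer gives `≤ K⊥ · X`. No smallness of `K⊥ X` is
needed for the inequality; it is informative when `K⊥ X < 1` — in temperature units `J⊥ · χ₂^{per}(J∥/T) < T`, the
interlayer mean-field (RPA) ordering criterion read as a one-sided bound.
[cite: Lieb1980, eq. (23) and notes added in proof (2); Rivasseau1980, Theorem; AizenmanSimon1980LocalWard, Thm 3.1 (N = 2) and Remark 4; Simon1980CMP, Thm 1.3; LiuStanley1972, p. 272 (layers (J, J, εJ))] -/
theorem torusXY_expectJ_cosDiff_layered_le_pow_interlayer (hL : 3 ≤ L) {Kp Kz : ℝ} (hp : 0 ≤ Kp) (hz : 0 ≤ Kz)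
    {X : ℝ} (hX : ∀ w : TorusSite 2 L, ∑ v : TorusSite 2 L, (torusXY 2 L).expectJ (fun _ => Kp) (cosDiff w v) ≤ X)
    (a c : TorusSite 3 L) :
    (torusXY 3 L).expectJ (fun b => layeredCoupling Kp Kz b.2) (cosDiff a c) ≤
      (Kz * X) ^ ((a - c) 2).valMinAbs.natAbs := by
  classical
  have hL2 : 2 ≤ L := by omega
  have hK : ∀ i, 0 ≤ layeredCoupling Kp Kz i := fun i => layeredCoupling_nonneg hp hz i
  -- the symmetrised pair coupling of the layered torus model
  set J : TorusSite 3 L × TorusSite 3 L → ℝ :=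
    symmCoupling ((torusXY 3 L).pairCoupling fun b => layeredCoupling Kp Kz b.2) with hJdef
  have hJ0 : ∀ p, 0 ≤ J p := torusXY_symmCoupling_fun_nonneg hK
  have hJval : ∀ (y : TorusSite 3 L) (i : Fin 3), J (y, y + Pi.single i 1) = layeredCoupling Kp Kz i / 2 ∧
      J (y + Pi.single i 1, y) = layeredCoupling Kp Kz i / 2 := fun y i => torusXY_symmCoupling_add_single hL _ y i
  have hJadj : ∀ p : TorusSite 3 L × TorusSite 3 L, J p ≠ 0 →
      ∃ i : Fin 3, p.1 + Pi.single i 1 = p.2 ∨ p.2 + Pi.single i 1 = p.1 := fun p hp =>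
    torusXY_exists_single_of_symmCoupling_ne_zero hp
  rw [(torusXY 3 L).expectJ_cosDiff_eq_twoPoint, ← twoPoint_symmCoupling]
  -- regions: the layer of `x` with its two neighbouring layers; shells: the two neighbouring layers
  set cd : TorusSite 3 L → TorusSite 3 L → ℕ := fun x y => ((y - x) 2).valMinAbs.natAbs with hcd
  set A : TorusSite 3 L → Finset (TorusSite 3 L) := fun x => univ.filter fun y => cd x y ≤ 1 with hAdef
  set S : TorusSite 3 L → Finset (TorusSite 3 L) := fun x => univ.filter fun y => cd x y = 1 with hSdef
  have memA : ∀ x y, y ∈ A x ↔ cd x y ≤ 1 := fun x y => by simp [hAdef]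
  have memS : ∀ x y, y ∈ S x ↔ cd x y = 1 := fun x y => by simp [hSdef]
  have hcd_comm : ∀ x y, cd x y = cd y x := fun x y => natAbs_valMinAbs_coord_comm y x 2
  have hcd_self : ∀ x, cd x x = 0 := fun x => natAbs_valMinAbs_coord_self x 2
  have hcd_zero : ∀ x y, cd x y = 0 ↔ y 2 = x 2 := fun x y => natAbs_valMinAbs_coord_eq_zero_iff x y 2
  have hcd_adj : ∀ (x : TorusSite 3 L) {y z : TorusSite 3 L} {i : Fin 3},
      (y + Pi.single i 1 = z ∨ z + Pi.single i 1 = y) → cd x y ≤ cd x z + 1 ∧ cd x z ≤ cd x y + 1 :=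
    fun x y z i h => natAbs_valMinAbs_coord_adj hL2 x h 2
  have hxA : ∀ x, x ∈ A x := fun x => by rw [memA, hcd_self]; exact zero_le_one
  refine twoPoint_le_pow_of_shell_rowSum_le hJ0 A S (fun x y hy => ?_) hxA (fun x p hp => ?_)
    (s := Kz * X) (fun x => ?_) c (d := fun y => cd c y) (fun x hx hcA => ?_) (fun x b hb => ?_) a
  · -- `S x ⊆ A x`
    rw [memA]; rw [memS] at hy; omega
  · -- every bond leaving `A x` starts on the shell
    obtain ⟨i, hi⟩ := hJadj p hp
    have h12 := hcd_adj x hi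
    constructor
    · intro h1 h2
      rw [memA] at h1 h2; rw [memS]; omega
    · intro h2 h1
      rw [memA] at h1 h2; rw [memS]; omega
  · -- THE SHELL ROW SUM: `∑_{b ∈ S x} ⟨cos(θ_x − θ_b)⟩_{touching(x)} ≤ K⊥ · X`
    -- the layer of `x`
    set Lay : Finset (TorusSite 3 L) := univ.filter fun y => y 2 = x 2 with hLaydef
    have memLay : ∀ y, y ∈ Lay ↔ y 2 = x 2 := fun y => by simp [hLaydef]
    have hxLay : x ∈ Lay := (memLay x).2 rfl
    have hLayA : ∀ y, y ∈ Lay → y ∈ A x := fun y hy => by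
      rw [memA, (hcd_zero x y).2 ((memLay y).1 hy)]; exact zero_le_one
    have hLayS : ∀ y, y ∈ Lay → y ∉ S x := fun y hy hyS => by
      rw [memS, (hcd_zero x y).2 ((memLay y).1 hy)] at hyS; exact zero_ne_one hyS
    have hA_cases : ∀ y, y ∈ A x → y ∈ Lay ∨ y ∈ S x := fun y hy => by
      rw [memA] at hy; rw [memLay, ← hcd_zero x y, memS]; omega
    -- in-plane couplings of the layer and the vertical (dangling) couplings of the touching system
    set Jin : TorusSite 3 L × TorusSite 3 L → ℝ := fun p => if p.1 ∈ Lay ∧ p.2 ∈ Lay then J p else 0 with hJin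
    set D : TorusSite 3 L × TorusSite 3 L → ℝ :=
      fun p => if (p.1 ∈ Lay ∧ p.2 ∈ S x) ∨ (p.1 ∈ S x ∧ p.2 ∈ Lay) then J p else 0 with hD
    have hJin0 : ∀ p, 0 ≤ Jin p := fun p => by simp only [hJin]; split_ifs; exacts [hJ0 p, le_rfl]
    have hD0 : ∀ p, 0 ≤ D p := fun p => by simp only [hD]; split_ifs; exacts [hJ0 p, le_rfl]
    have hDle : ∀ p, D p ≤ J p := fun p => by simp only [hD]; split_ifs; exacts [le_rfl, hJ0 p]
    have hD_J : ∀ p, D p ≠ 0 → J p ≠ 0 := fun p hp h => hp (by simp only [hD, h, ite_self])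
    have hJin_supp : ∀ p, Jin p ≠ 0 → p.1 ∈ Lay ∧ p.2 ∈ Lay := fun p hp => by
      by_contra h; exact hp (by simp only [hJin, if_neg h])
    -- the touching system splits as in-plane + dangling
    have hsplit : insideCoupling J (A x) (S x) = Jin + D := by
      funext p
      simp only [insideCoupling, hJin, hD, Pi.add_apply]
      by_cases h1 : p.1 ∈ Lay <;> by_cases h2 : p.2 ∈ Lay
      · simp [h1, h2, hLayA _ h1, hLayA _ h2, hLayS _ h1, hLayS _ h2]
      · by_cases h2S : p.2 ∈ S x
        · have hA2 : p.2 ∈ A x := (memA x _).2 (le_of_eq ((memS x _).1 h2S))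
          simp [h1, h2, hLayA _ h1, hA2, hLayS _ h1, h2S]
        · have hA2 : p.2 ∉ A x := fun h => (hA_cases _ h).elim h2 h2S
          simp [h1, h2, hA2, h2S]
      · by_cases h1S : p.1 ∈ S x
        · have hA1 : p.1 ∈ A x := (memA x _).2 (le_of_eq ((memS x _).1 h1S))
          simp [h1, h2, hLayA _ h2, hA1, hLayS _ h2, h1S]
        · have hA1 : p.1 ∉ A x := fun h => (hA_cases _ h).elim h1 h1S
          simp [h1, h2, hA1, h1S]
      · by_cases h1S : p.1 ∈ S x
        · by_cases h2S : p.2 ∈ S x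
          · simp [h1, h2, h1S, h2S]
          · have hA2 : p.2 ∉ A x := fun h => (hA_cases _ h).elim h2 h2S
            simp [h1, h2, hA2, h1S, h2S]
        · have hA1 : p.1 ∉ A x := fun h => (hA_cases _ h).elim h1 h1S
          simp [h1, h2, hA1, h1S]
    -- the vertical foot of a site: same in-plane coordinates, layer of `x`
    set foot : TorusSite 3 L → TorusSite 3 L := fun v => Function.update v 2 (x 2) with hfoot
    have hfootLay : ∀ v, v ∉ Lay → foot v ∈ Lay := fun v _ => by
      rw [memLay]; simp [hfoot]
    have hDsupp : ∀ p, D p ≠ 0 → (p.1 ∉ Lay ∧ p.2 = foot p.1) ∨ (p.2 ∉ Lay ∧ p.1 = foot p.2) := by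
      intro p hp
      have hcond : (p.1 ∈ Lay ∧ p.2 ∈ S x) ∨ (p.1 ∈ S x ∧ p.2 ∈ Lay) := by
        by_contra h; exact hp (by simp only [hD, if_neg h])
      obtain ⟨i, hi⟩ := hJadj p (hD_J p hp)
      rcases hcond with ⟨h1, h2⟩ | ⟨h1, h2⟩
      · have h2' : p.2 ∉ Lay := fun h => hLayS _ h h2
        refine Or.inr ⟨h2', ?_⟩
        exact (update_two_eq_of_adj hL2 ((memLay _).1 h1) (fun h => h2' ((memLay _).2 h)) hi).symm
      · have h1' : p.1 ∉ Lay := fun h => hLayS _ h h1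
        refine Or.inl ⟨h1', ?_⟩
        exact (update_two_eq_of_adj hL2 ((memLay _).1 h2) (fun h => h1' ((memLay _).2 h)) hi.symm).symm
    -- the leaf bound at every shell site
    have hleaf : ∀ b ∈ S x, PlaneRotator.twoPoint (insideCoupling J (A x) (S x)) x b ≤
        (1 / 2) * ∑ y ∈ Lay, (D (b, y) + D (y, b)) * PlaneRotator.twoPoint Jin y x := by
      intro b hb
      rw [hsplit]
      exact twoPoint_add_leaf_le hfootLay hJin_supp hDsupp hJin0 hD0 hxLay (fun h => hLayS b h hb)
    -- vertical coordination: at a layer site the dangling couplings to the shell sum to at most `2K⊥`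
    have e2 : layeredCoupling Kp Kz 2 = Kz := by simp [layeredCoupling]
    have hvert : ∀ y ∈ Lay, ∑ b ∈ S x, (D (b, y) + D (y, b)) ≤ 2 * Kz := by
      intro y hy
      set g : TorusSite 3 L → ℝ := fun b =>
        (if b = y + Pi.single (2 : Fin 3) (1 : ZMod L) then Kz else 0) +
          (if b = y - Pi.single (2 : Fin 3) (1 : ZMod L) then Kz else 0) with hg
      have hg0 : ∀ b, 0 ≤ g b := fun b => add_nonneg (ite_nonneg hz le_rfl) (ite_nonneg hz le_rfl)
      have hle : ∀ b ∈ S x, D (b, y) + D (y, b) ≤ g b := by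
        intro b hb
        have hbLay : b ∉ Lay := fun h => hLayS b h hb
        by_cases hb1 : b = y + Pi.single (2 : Fin 3) (1 : ZMod L)
        · have hval := hJval y 2
          rw [← hb1, e2] at hval
          calc D (b, y) + D (y, b) ≤ J (b, y) + J (y, b) := add_le_add (hDle _) (hDle _)
            _ = Kz := by rw [hval.1, hval.2]; ring
            _ ≤ g b := by
                have h0 : 0 ≤ (if b = y - Pi.single (2 : Fin 3) (1 : ZMod L) then Kz else 0) :=
                  ite_nonneg hz le_rfl
                simp only [hg, if_pos hb1]; linarith
        by_cases hb2 : b = y - Pi.single (2 : Fin 3) (1 : ZMod L)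
        · have hby : b + Pi.single (2 : Fin 3) (1 : ZMod L) = y := by rw [hb2]; abel
          have hval := hJval b 2
          rw [hby, e2] at hval
          calc D (b, y) + D (y, b) ≤ J (b, y) + J (y, b) := add_le_add (hDle _) (hDle _)
            _ = Kz := by rw [hval.1, hval.2]; ring
            _ ≤ g b := by
                have h0 : 0 ≤ (if b = y + Pi.single (2 : Fin 3) (1 : ZMod L) then Kz else 0) :=
                  ite_nonneg hz le_rfl
                simp only [hg, if_pos hb2]; linarith
        · -- no bond between `y` and `b`: both dangling couplings vanish
          have hnoadj : ∀ i : Fin 3, ¬(b + Pi.single i 1 = y ∨ y + Pi.single i 1 = b) := by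
            intro i hi
            have hi2 : i = 2 := by
              by_contra hi2
              rcases hi with h | h
              · have h' := (apply_two_add_single_eq_iff hL2 b i).2 hi2
                rw [h] at h'
                exact hbLay ((memLay b).2 (h'.symm.trans ((memLay y).1 hy)))
              · have h' := (apply_two_add_single_eq_iff hL2 y i).2 hi2
                rw [h] at h'
                exact hbLay ((memLay b).2 (h'.trans ((memLay y).1 hy)))
            subst hi2
            rcases hi with h | h
            · exact hb2 (eq_sub_of_add_eq h)
            · exact hb1 h.symm
          have hDby : D (b, y) = 0 := by
            by_contra h
            obtain ⟨i, hi⟩ := hJadj (b, y) (hD_J _ h)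
            exact hnoadj i hi
          have hDyb : D (y, b) = 0 := by
            by_contra h
            obtain ⟨i, hi⟩ := hJadj (y, b) (hD_J _ h)
            exact hnoadj i hi.symm
          rw [hDby, hDyb, add_zero]
          exact hg0 b
      calc ∑ b ∈ S x, (D (b, y) + D (y, b)) ≤ ∑ b ∈ S x, g b := Finset.sum_le_sum hle
        _ ≤ ∑ b, g b := Finset.sum_le_sum_of_subset_of_nonneg (Finset.subset_univ _) fun b _ _ => hg0 b
        _ = Kz + Kz := by
            simp only [hg, Finset.sum_add_distrib, Finset.sum_ite_eq', Finset.mem_univ, if_true]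
        _ = 2 * Kz := by ring
    -- the in-plane two-point function of the layer alone is the two-dimensional torus model's
    have hinplane : ∑ y ∈ Lay, PlaneRotator.twoPoint Jin x y ≤ X := by
      set π : TorusSite 3 L → TorusSite 2 L := fun v j => v (Fin.castSucc j) with hπ
      have hπinj : Set.InjOn π Lay := by
        intro y hy z hz hyz
        funext j
        by_cases hj : j = Fin.last 2
        · rw [hj]
          have hy2 : y 2 = x 2 := (memLay y).1 hy
          have hz2 : z 2 = x 2 := (memLay z).1 hz
          exact hy2.trans hz2.symm
        · obtain ⟨j', rfl⟩ := Fin.exists_castSucc_eq.2 hj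
          exact congr_fun hyz j'
      set J2 : TorusSite 2 L × TorusSite 2 L → ℝ :=
        symmCoupling ((torusXY 2 L).pairCoupling fun _ => Kp) with hJ2
      have hJ2_0 : ∀ p, 0 ≤ J2 p := torusXY_symmCoupling_fun_nonneg (K := fun _ : Fin 2 => Kp) fun _ => hp
      have hval2 : ∀ (w : TorusSite 2 L) (i : Fin 2), J2 (w, w + Pi.single i 1) = Kp / 2 ∧
          J2 (w + Pi.single i 1, w) = Kp / 2 := fun w i =>
        torusXY_symmCoupling_add_single (d := 2) hL (fun _ : Fin 2 => Kp) w i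
      have hdom : ∀ y ∈ Lay, ∀ z ∈ Lay, Jin (y, z) ≤ J2 (π y, π z) := by
        intro y hy z hz
        simp only [hJin, if_pos (And.intro hy hz)]
        by_cases hJyz : J (y, z) = 0
        · rw [hJyz]; exact hJ2_0 _
        obtain ⟨i, hi⟩ := hJadj (y, z) hJyz
        have hyz2 : z 2 = y 2 := ((memLay z).1 hz).trans ((memLay y).1 hy).symm
        -- an in-plane bond
        have hi2 : i ≠ Fin.last 2 := by
          intro hi2; subst hi2
          rcases hi with h | h
          · have h' := apply_two_add_single_eq_iff hL2 y (Fin.last 2)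
            rw [h] at h'
            exact (h'.1 hyz2) rfl
          · have h' := apply_two_add_single_eq_iff hL2 z (Fin.last 2)
            rw [h] at h'
            exact (h'.1 hyz2.symm) rfl
        obtain ⟨i', rfl⟩ := Fin.exists_castSucc_eq.2 hi2
        have eK : layeredCoupling Kp Kz (Fin.castSucc i') = Kp := by
          fin_cases i' <;> simp [layeredCoupling]
        rcases hi with h | h
        · -- `z = y + eᵢ`
          simp only at h
          rw [← h, (hJval y _).1, eK, show π (y + Pi.single (Fin.castSucc i') 1) = π y + Pi.single i' 1 from
            proj_add_single_castSucc y i', (hval2 (π y) i').1]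
        · -- `y = z + eᵢ`
          simp only at h
          rw [← h, (hJval z _).2, eK, show π (z + Pi.single (Fin.castSucc i') 1) = π z + Pi.single i' 1 from
            proj_add_single_castSucc z i', (hval2 (π z) i').2]
      calc ∑ y ∈ Lay, PlaneRotator.twoPoint Jin x y ≤ ∑ y ∈ Lay, PlaneRotator.twoPoint J2 (π x) (π y) :=
            Finset.sum_le_sum fun y hy => twoPoint_le_of_injOn hJin0 hJin_supp π hπinj hJ2_0 hdom hxLay hy
        _ = ∑ w ∈ Lay.image π, PlaneRotator.twoPoint J2 (π x) w := by
            rw [Finset.sum_image fun y hy z hz h => hπinj hy hz h]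
        _ ≤ ∑ w, PlaneRotator.twoPoint J2 (π x) w :=
            Finset.sum_le_sum_of_subset_of_nonneg (Finset.subset_univ _) fun w _ _ => twoPoint_nonneg hJ2_0 _ _
        _ = ∑ v, (torusXY 2 L).expectJ (fun _ => Kp) (cosDiff (π x) v) := by
            refine Finset.sum_congr rfl fun v _ => ?_
            rw [(torusXY 2 L).expectJ_cosDiff_eq_twoPoint, hJ2, twoPoint_symmCoupling]
        _ ≤ X := hX (π x)
    -- assemble
    calc ∑ b ∈ S x, PlaneRotator.twoPoint (insideCoupling J (A x) (S x)) x b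
        ≤ ∑ b ∈ S x, (1 / 2) * ∑ y ∈ Lay, (D (b, y) + D (y, b)) * PlaneRotator.twoPoint Jin y x :=
          Finset.sum_le_sum hleaf
      _ = (1 / 2) * ∑ y ∈ Lay, PlaneRotator.twoPoint Jin y x * ∑ b ∈ S x, (D (b, y) + D (y, b)) := by
          rw [← Finset.mul_sum, Finset.sum_comm]
          congr 1
          refine Finset.sum_congr rfl fun y _ => ?_
          rw [Finset.mul_sum]
          exact Finset.sum_congr rfl fun b _ => by ring
      _ ≤ (1 / 2) * ∑ y ∈ Lay, PlaneRotator.twoPoint Jin y x * (2 * Kz) := by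
          gcongr with y hy
          · exact twoPoint_nonneg hJin0 _ _
          · exact hvert y hy
      _ = Kz * ∑ y ∈ Lay, PlaneRotator.twoPoint Jin x y := by
          rw [← Finset.sum_mul, show (∑ y ∈ Lay, PlaneRotator.twoPoint Jin y x) = ∑ y ∈ Lay, PlaneRotator.twoPoint Jin x y from
            Finset.sum_congr rfl fun y _ => PlaneRotator.twoPoint_comm _ _ _]
          ring
      _ ≤ Kz * X := mul_le_mul_of_nonneg_left hinplane hz
  · -- `cd c x ≠ 0` and `c ∈ A x` force `c ∈ S x`
    rw [memS]; rw [memA] at hcA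
    rw [hcd_comm] at hx
    omega
  · -- the layer distance to `c` drops by at most one across the shell of `x`
    have hb1 : cd x b = 1 := (memS x b).1 hb
    have htri : cd c x ≤ cd c b + cd b x := by
      simp only [hcd]
      have := natAbs_valMinAbs_coord_le c b x 2
      exact this
    rw [hcd_comm b x, hb1] at htri
    exact htri

/-- **The periodic susceptibility of the layer does not depend on the base point** (torus translations):
`∑_v ⟨cos(θ_w − θ_v)⟩_{K,L} = ∑_v ⟨cos(θ_0 − θ_v)⟩_{K,L}`. [cite: FriedliVelenik2017, §3.1 (periodic boundary condition: translation invariance) — plumbing] -/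
theorem torusXY_sum_expectJ_cosDiff_eq_zero_base {d : ℕ} (K : ℝ) (w : TorusSite d L) :
    ∑ v, (torusXY d L).expectJ (fun _ => K) (cosDiff w v) = ∑ v, (torusXY d L).expectJ (fun _ => K) (cosDiff 0 v) := by
  refine Fintype.sum_equiv (Equiv.subRight w) _ _ fun v => ?_
  have h := torusXY_expectJ_cosDiff_add_right (d := d) (L := L) (fun _ => K) 0 (v - w) w
  simp only [zero_add, sub_add_cancel] at h
  exact h

/-- The periodic susceptibility of the layer is non-negative (Griffiths' first inequality termwise).
[cite: Ginibre1970, Example 4 (plane rotators) — plumbing] -/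
theorem torusXY_sum_expectJ_cosDiff_nonneg {d : ℕ} {K : ℝ} (hK : 0 ≤ K) (w : TorusSite d L) :
    0 ≤ ∑ v, (torusXY d L).expectJ (fun _ => K) (cosDiff w v) :=
  Finset.sum_nonneg fun v _ => by
    rw [(torusXY d L).expectJ_cosDiff_eq_twoPoint]
    exact twoPoint_nonneg ((torusXY d L).pairCoupling_nonneg fun _ => hK) w v

end Criterion

/-! ## §3 Layer sums: `∑_{ℓ ∈ ℤ/L} A^{|ℓ|} ≤ (1 + A)/(1 − A)` -/

section LayerSum

/-- **The two-sided geometric series**: `∑_{m ∈ ℤ} A^{|m|} = (1 + A)/(1 − A)` for `0 ≤ A < 1`.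
[cite: Simon1980CMP, Thm 1.3 (exponential decay summed over the lattice) — plumbing] -/
theorem hasSum_pow_natAbs_int {A : ℝ} (hA0 : 0 ≤ A) (hA1 : A < 1) :
    HasSum (fun m : ℤ => A ^ m.natAbs) ((1 + A) / (1 - A)) := by
  have h1 : HasSum (fun n : ℕ => (fun m : ℤ => A ^ m.natAbs) (n : ℤ)) (1 - A)⁻¹ := by
    have e : (fun n : ℕ => (fun m : ℤ => A ^ m.natAbs) (n : ℤ)) = fun n : ℕ => A ^ n := by
      funext n; simp only [Int.natAbs_natCast]
    rw [e]; exact hasSum_geometric_of_lt_one hA0 hA1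
  have h2 : HasSum (fun n : ℕ => (fun m : ℤ => A ^ m.natAbs) (-(n + 1 : ℤ))) (A * (1 - A)⁻¹) := by
    have e : (fun n : ℕ => (fun m : ℤ => A ^ m.natAbs) (-(n + 1 : ℤ))) = fun n : ℕ => A * A ^ n := by
      funext n
      have hn : (-(n + 1 : ℤ)).natAbs = n + 1 := by omega
      simp only [hn, pow_succ']
    rw [e]; exact (hasSum_geometric_of_lt_one hA0 hA1).mul_left A
  have h : HasSum (fun m : ℤ => A ^ m.natAbs) ((1 - A)⁻¹ + A * (1 - A)⁻¹) :=
    HasSum.of_nat_of_neg_add_one h1 h2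
  have hv : (1 - A)⁻¹ + A * (1 - A)⁻¹ = (1 + A) / (1 - A) := by rw [div_eq_mul_inv]; ring
  rwa [hv] at h

/-- **The layer sum on the cyclic group**: `∑_{ℓ ∈ ℤ/L} A^{|valMinAbs ℓ|} ≤ (1 + A)/(1 − A)` for `0 ≤ A < 1`
(`valMinAbs` is injective into `ℤ`). [cite: Simon1980CMP, Thm 1.3 (exponential decay summed over the lattice) — plumbing] -/
theorem sum_pow_natAbs_valMinAbs_le {A : ℝ} (hA0 : 0 ≤ A) (hA1 : A < 1) :
    ∑ k : ZMod L, A ^ k.valMinAbs.natAbs ≤ (1 + A) / (1 - A) := by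
  classical
  have hs := hasSum_pow_natAbs_int hA0 hA1
  calc ∑ k : ZMod L, A ^ k.valMinAbs.natAbs
      = ∑ m ∈ (Finset.univ : Finset (ZMod L)).image ZMod.valMinAbs, A ^ m.natAbs := by
        rw [Finset.sum_image fun a _ b _ h => ZMod.injective_valMinAbs h]
    _ ≤ ∑' m : ℤ, A ^ m.natAbs := hs.summable.sum_le_tsum _ fun m _ => pow_nonneg hA0 _
    _ = (1 + A) / (1 - A) := hs.tsum_eq

/-- **Slices of the torus**: `∑_{y ∈ (ℤ/L)³} f(y₂) = L² ∑_{k ∈ ℤ/L} f(k)`. [cite: FriedliVelenik2017, §3.1 (the torus) — plumbing] -/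
theorem sum_torusSite_three_apply_two (f : ZMod L → ℝ) :
    ∑ y : TorusSite 3 L, f (y 2) = (L : ℝ) ^ 2 * ∑ k : ZMod L, f k := by
  classical
  rw [Fintype.sum_equiv (Equiv.piSplitAt 2 (fun _ : Fin 3 => ZMod L)) (fun v => f (v 2))
      (fun q => f q.1) (fun v => rfl), Fintype.sum_prod_type]
  simp only [Finset.sum_const, Finset.card_univ, nsmul_eq_mul]
  rw [← Finset.mul_sum]
  congr 1
  rw [Fintype.card_fun, ZMod.card, Fintype.card_subtype_compl, Fintype.card_fin, Fintype.card_unique]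
  push_cast
  ring

/-- **The torus sum of an across-layer decay bound**: for `0 ≤ A < 1` and every base point `x`,
`∑_{y ∈ (ℤ/L)³} A^{d₂(x,y)} ≤ L² · (1 + A)/(1 − A)` (`L²` sites per layer, the layer sum of the previous lemma).
[cite: Simon1980CMP, Thm 1.3 (exponential decay summed over the lattice) — plumbing] -/
theorem sum_pow_layerDist_le {A : ℝ} (hA0 : 0 ≤ A) (hA1 : A < 1) (x : TorusSite 3 L) :
    ∑ y : TorusSite 3 L, A ^ ((x - y) 2).valMinAbs.natAbs ≤ (L : ℝ) ^ 2 * ((1 + A) / (1 - A)) := by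
  have h := sum_torusSite_three_apply_two (L := L) (fun k => A ^ (x 2 - k).valMinAbs.natAbs)
  have e : ∀ y : TorusSite 3 L, ((x - y) 2).valMinAbs.natAbs = (x 2 - y 2).valMinAbs.natAbs := fun y => rfl
  simp only [e]
  rw [h]
  refine mul_le_mul_of_nonneg_left ?_ (by positivity)
  calc ∑ k : ZMod L, A ^ (x 2 - k).valMinAbs.natAbs = ∑ k : ZMod L, A ^ k.valMinAbs.natAbs :=
        Fintype.sum_equiv (Equiv.subLeft (x 2)) _ _ (fun k => rfl)
    _ ≤ (1 + A) / (1 - A) := sum_pow_natAbs_valMinAbs_le hA0 hA1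

/-- **Polynomial × geometric**: `(n + 1)^k rⁿ → 0` for `|r| < 1`. [cite: Simon1980CMP, Thm 1.3 — plumbing] -/
theorem tendsto_succ_pow_mul_geom {r : ℝ} (hr : |r| < 1) (k : ℕ) :
    Tendsto (fun n : ℕ => ((n : ℝ) + 1) ^ k * r ^ n) atTop (𝓝 0) := by
  have h := (tendsto_pow_const_mul_const_pow_of_abs_lt_one k (r := |r|) (by rwa [abs_abs])).const_mul
    ((2 : ℝ) ^ k)
  rw [mul_zero] at h
  have hbound : ∀ᶠ n : ℕ in atTop, |((n : ℝ) + 1) ^ k * r ^ n| ≤ (2 : ℝ) ^ k * ((n : ℝ) ^ k * |r| ^ n) := by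
    filter_upwards [eventually_ge_atTop 1] with n hn
    have hn' : (1 : ℝ) ≤ n := by exact_mod_cast hn
    rw [abs_mul, abs_pow, abs_pow, abs_of_nonneg (by positivity : (0 : ℝ) ≤ (n : ℝ) + 1), ← mul_assoc,
      ← mul_pow]
    refine mul_le_mul_of_nonneg_right (pow_le_pow_left₀ (by positivity) (by linarith) k) (by positivity)
  exact squeeze_zero_norm' hbound h

end LayerSum

/-! ## §4 No three-dimensional order under the interlayer criterion: susceptibility, plateau, c-axis stiffness -/

namespace AnisotropicRotator

/- The floor files fix the Borel structure of `Circle` as a global instance (`corr`, `plateau`); the instance-generic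
theorems of §2 are used at that instance below. -/

/-- `0 ≤ plateau_L(K)` for `K ≥ 0` (Griffiths' first inequality termwise). [cite: FriedliVelenikSMLS2017, (10.39)–(10.42) (the plateau) — plumbing] -/
theorem plateau_nonneg {K : Fin 3 → ℝ} (hK : ∀ i, 0 ≤ K i) : 0 ≤ plateau L K := by
  unfold plateau
  exact div_nonneg (Finset.sum_nonneg fun x _ => Finset.sum_nonneg fun y _ => corr_nonneg hK x y) (by positivity)

/-- **The interlayer criterion for the layered XY model on `(ℤ/Lℤ)³` (two-point form).** For `K∥, K⊥ ≥ 0`, `L ≥ 3` and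
any `X` with `∑_v ⟨cos(θ_w − θ_v)⟩^{2D}_{K∥,L} ≤ X` for all `w` (a ceiling on the layer's periodic susceptibility):

  `corr (K∥, K∥, K⊥) x y ≤ (K⊥ · X)^{d₂(x,y)}`,  `d₂` the cyclic layer distance,

at every volume. In temperature units (`K∥ = J∥/T`, `K⊥ = J⊥/T`, `X = χ₂^{per}(J∥/T)`): across-layer correlations decay
like `(J⊥ χ₂/T)^{|Δℓ|}` as soon as `J⊥ · χ₂(T) < T`. [cite: Lieb1980, eq. (23); Rivasseau1980, Theorem; AizenmanSimon1980LocalWard, Thm 3.2 and Remark 4 (decay by iterating a local inequality); LiuStanley1972, p. 272 (layers (J, J, εJ))] -/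
theorem corr_layered_le_pow_interlayer (hL : 3 ≤ L) {Kp Kz : ℝ} (hp : 0 ≤ Kp) (hz : 0 ≤ Kz) {X : ℝ}
    (hX : ∀ w : TorusSite 2 L, ∑ v : TorusSite 2 L, (torusXY 2 L).expectJ (fun _ => Kp) (cosDiff w v) ≤ X)
    (x y : TorusSite 3 L) :
    corr (layeredCoupling Kp Kz) x y ≤ (Kz * X) ^ ((x - y) 2).valMinAbs.natAbs := by
  rw [corr_eq_expectJ]
  exact torusXY_expectJ_cosDiff_layered_le_pow_interlayer hL hp hz hX x y

/-- The same with the susceptibility ceiling given at the base point `0` only (translation invariance).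
[cite: Lieb1980, eq. (23); AizenmanSimon1980LocalWard, Remark 4; LiuStanley1972, p. 272] -/
theorem corr_layered_le_pow_interlayer' (hL : 3 ≤ L) {Kp Kz : ℝ} (hp : 0 ≤ Kp) (hz : 0 ≤ Kz) {X : ℝ}
    (hX : ∑ v : TorusSite 2 L, (torusXY 2 L).expectJ (fun _ => Kp) (cosDiff 0 v) ≤ X) (x y : TorusSite 3 L) :
    corr (layeredCoupling Kp Kz) x y ≤ (Kz * X) ^ ((x - y) 2).valMinAbs.natAbs :=
  corr_layered_le_pow_interlayer hL hp hz (fun w => by rwa [torusXY_sum_expectJ_cosDiff_eq_zero_base Kp w]) x y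

/-- **The stack's periodic susceptibility under the interlayer criterion**: if moreover `A := K⊥ · X < 1`, then
`∑_y corr (K∥, K∥, K⊥) x y ≤ L² · (1 + A)/(1 − A)` for every `x` — of the order of ONE layer (`L²` sites), not of the
volume. [cite: Simon1980CMP, Thm 1.3 (decay summed over the lattice); Lieb1980, eq. (23); LiuStanley1972, p. 272] -/
theorem sum_corr_layered_le_interlayer (hL : 3 ≤ L) {Kp Kz : ℝ} (hp : 0 ≤ Kp) (hz : 0 ≤ Kz) {X : ℝ}
    (hX : ∀ w : TorusSite 2 L, ∑ v : TorusSite 2 L, (torusXY 2 L).expectJ (fun _ => Kp) (cosDiff w v) ≤ X)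
    (hA : Kz * X < 1) (x : TorusSite 3 L) :
    ∑ y, corr (layeredCoupling Kp Kz) x y ≤ (L : ℝ) ^ 2 * ((1 + Kz * X) / (1 - Kz * X)) := by
  have hA0 : 0 ≤ Kz * X := mul_nonneg hz ((torusXY_sum_expectJ_cosDiff_nonneg hp 0).trans (hX 0))
  exact (Finset.sum_le_sum fun y _ => corr_layered_le_pow_interlayer hL hp hz hX x y).trans
    (sum_pow_layerDist_le hA0 hA x)

/-- **NO LONG-RANGE ORDER under the interlayer criterion.** For `K∥, K⊥ ≥ 0`, `L ≥ 3` and a layer susceptibility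
ceiling `X` (at every base point) with `A := K⊥ · X < 1`:

  `plateau_L(K∥, K∥, K⊥) ≤ (1 + A) / ((1 − A) · L)`,

an explicit `O(1/L)` ceiling on the long-range-order parameter of the stack. In temperature units: `J⊥ · χ₂^{per}(J∥/T) < T`
— the interlayer mean-field (RPA) ordering criterion `z⊥ J⊥ (β/2) ∑⟨cos⟩ = 1` read ONE-SIDEDLY — certifies the absence
of three-dimensional long-range order; the LRO temperature of the layered rotator is at most
`T_×(J∥, J⊥) := inf{T : J⊥ χ₂(J∥/T) < T}`. (No statement about `χ^{3D} < ∞` or in-plane decay: same-layer pairs are not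
separated by the layers.) [cite: Lieb1980, eq. (23) and p. 128; Simon1980CMP, Thm 1.3; FriedliVelenikSMLS2017, (10.39)–(10.42) (the plateau); LiuStanley1972, p. 272 (T_c(ε) of the layers (J, J, εJ))] -/
theorem plateau_layered_le_interlayer (hL : 3 ≤ L) {Kp Kz : ℝ} (hp : 0 ≤ Kp) (hz : 0 ≤ Kz) {X : ℝ}
    (hX : ∀ w : TorusSite 2 L, ∑ v : TorusSite 2 L, (torusXY 2 L).expectJ (fun _ => Kp) (cosDiff w v) ≤ X)
    (hA : Kz * X < 1) :
    plateau L (layeredCoupling Kp Kz) ≤ (1 + Kz * X) / ((1 - Kz * X) * L) := by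
  have hL0 : (0 : ℝ) < (L : ℝ) := by exact_mod_cast (show 0 < L by omega)
  have hA1 : 0 < 1 - Kz * X := by linarith
  have hrow := sum_corr_layered_le_interlayer hL hp hz hX hA
  have hcard : (Finset.univ : Finset (TorusSite 3 L)).card = L ^ 3 := by
    rw [Finset.card_univ, card_torusSite]
  unfold plateau
  rw [div_le_div_iff₀ (by positivity) (by positivity)]
  calc (∑ x : TorusSite 3 L, ∑ y : TorusSite 3 L, corr (layeredCoupling Kp Kz) x y) * ((1 - Kz * X) * L)
      ≤ (∑ _x : TorusSite 3 L, (L : ℝ) ^ 2 * ((1 + Kz * X) / (1 - Kz * X))) * ((1 - Kz * X) * L) :=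
        mul_le_mul_of_nonneg_right (Finset.sum_le_sum fun x _ => hrow x) (by positivity)
    _ = (1 + Kz * X) * (L : ℝ) ^ 6 := by
        rw [Finset.sum_const, hcard, nsmul_eq_mul]
        push_cast
        field_simp

/-- **The headline forms** `∑_y corr x y ≤ 2L²/(1 − A)` and `plateau_L ≤ 2/((1 − A)·L)` (from `1 + A ≤ 2`).
[cite: Lieb1980, eq. (23) and p. 128; Simon1980CMP, Thm 1.3; FriedliVelenikSMLS2017, (10.39)–(10.42) (the plateau)] -/
theorem plateau_layered_le_two_div (hL : 3 ≤ L) {Kp Kz : ℝ} (hp : 0 ≤ Kp) (hz : 0 ≤ Kz) {X : ℝ}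
    (hX : ∀ w : TorusSite 2 L, ∑ v : TorusSite 2 L, (torusXY 2 L).expectJ (fun _ => Kp) (cosDiff w v) ≤ X)
    (hA : Kz * X < 1) :
    (∀ x : TorusSite 3 L, ∑ y, corr (layeredCoupling Kp Kz) x y ≤ 2 * (L : ℝ) ^ 2 / (1 - Kz * X)) ∧
      plateau L (layeredCoupling Kp Kz) ≤ 2 / ((1 - Kz * X) * L) := by
  have hL0 : (0 : ℝ) < (L : ℝ) := by exact_mod_cast (show 0 < L by omega)
  have hA1 : 0 < 1 - Kz * X := by linarith
  have h2 : 1 + Kz * X ≤ 2 := by linarith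
  refine ⟨fun x => (sum_corr_layered_le_interlayer hL hp hz hX hA x).trans ?_,
    (plateau_layered_le_interlayer hL hp hz hX hA).trans
      (div_le_div_of_nonneg_right h2 (mul_pos hA1 hL0).le)⟩
  rw [mul_div_assoc', mul_comm (2 : ℝ)]
  rw [mul_div_assoc, mul_div_assoc]
  exact mul_le_mul_of_nonneg_left (div_le_div_of_nonneg_right h2 hA1.le) (by positivity)

/-- The same with the susceptibility ceiling at the base point `0`. [cite: Lieb1980, eq. (23) and p. 128; Simon1980CMP, Thm 1.3; FriedliVelenikSMLS2017, (10.39)–(10.42)] -/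
theorem plateau_layered_le_interlayer' (hL : 3 ≤ L) {Kp Kz : ℝ} (hp : 0 ≤ Kp) (hz : 0 ≤ Kz) {X : ℝ}
    (hX : ∑ v : TorusSite 2 L, (torusXY 2 L).expectJ (fun _ => Kp) (cosDiff 0 v) ≤ X) (hA : Kz * X < 1) :
    plateau L (layeredCoupling Kp Kz) ≤ (1 + Kz * X) / ((1 - Kz * X) * L) :=
  plateau_layered_le_interlayer hL hp hz (fun w => by rwa [torusXY_sum_expectJ_cosDiff_eq_zero_base Kp w]) hA

/-- **The plateau tends to zero under the interlayer criterion.** If the layer's periodic susceptibility is bounded by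
`X` for all `L ≥ L₀` and `K⊥ · X < 1`, then `plateau_{L+1}(K∥, K∥, K⊥) → 0` — the stack at these couplings has no
long-range order in the thermodynamic limit. [cite: FriedliVelenikSMLS2017, (10.39)–(10.42) (the plateau); Simon1980CMP, Thm 1.3; LiuStanley1972, p. 272] -/
theorem tendsto_plateau_layered_of_interlayer_lt_one {Kp Kz X : ℝ} (hp : 0 ≤ Kp) (hz : 0 ≤ Kz) {L₀ : ℕ}
    (hX : ∀ (L : ℕ) [NeZero L], L₀ ≤ L →
      ∑ v : TorusSite 2 L, (torusXY 2 L).expectJ (fun _ => Kp) (cosDiff 0 v) ≤ X)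
    (hA : Kz * X < 1) :
    Tendsto (fun L : ℕ => plateau (L + 1) (layeredCoupling Kp Kz)) atTop (𝓝 0) := by
  have hK : ∀ i, 0 ≤ layeredCoupling Kp Kz i := fun i => layeredCoupling_nonneg hp hz i
  have hlim : Tendsto (fun L : ℕ => ((1 + Kz * X) / (1 - Kz * X)) / (((L + 1 : ℕ) : ℕ) : ℝ)) atTop (𝓝 0) :=
    (tendsto_const_div_atTop_nhds_zero_nat _).comp (tendsto_add_atTop_nat 1)
  refine squeeze_zero' (Eventually.of_forall fun L => plateau_nonneg hK) ?_ hlim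
  filter_upwards [eventually_ge_atTop (max L₀ 2)] with L hL
  have hb := plateau_layered_le_interlayer' (L := L + 1) (by omega) hp hz (hX (L + 1) (by omega)) hA
  rwa [← div_div] at hb

/-- **The c-axis helicity modulus under the interlayer criterion, at every `L ≥ 4`**: with `A := K⊥ · X ≤ 1`,

  `|βΥ^{3D}_{L,e₃}(K∥, K∥, K⊥)| ≤ 4 K⊥² · L³ · A^{2(⌊L/2⌋ − 1)}`

(the across-layer decay at layer distance `≥ ⌊L/2⌋ − 1`, squared by the cut–cut covariance bound
`abs_torusXYDirStiffness_le_of_twoPoint_bound`). [cite: FisherBarberJasnow1973, §II eqs. (2.4)–(2.5) (helicity modulus); BricmontFontaineLandau1977, Appendix Thm A2; Lieb1980, eq. (23); LiuStanley1972, p. 272] -/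
theorem abs_torusXYDirStiffness_cAxis_le_interlayer (hL : 4 ≤ L) {Kp Kz X : ℝ} (hp : 0 ≤ Kp) (hz : 0 ≤ Kz)
    (hX : ∀ w : TorusSite 2 L, ∑ v : TorusSite 2 L, (torusXY 2 L).expectJ (fun _ => Kp) (cosDiff w v) ≤ X)
    (hA1 : Kz * X ≤ 1) :
    |torusXYDirStiffness L (layeredCoupling Kp Kz) 2| ≤
      4 * Kz ^ 2 * (L : ℝ) ^ 3 * ((Kz * X) ^ (L / 2 - 1)) ^ 2 := by
  have hK : ∀ m, 0 ≤ layeredCoupling Kp Kz m := fun m => layeredCoupling_nonneg hp hz m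
  have hA0 : 0 ≤ Kz * X := mul_nonneg hz ((torusXY_sum_expectJ_cosDiff_nonneg hp 0).trans (hX 0))
  have h := abs_torusXYDirStiffness_le_of_twoPoint_bound hL hK 2 (pow_nonneg hA0 (L / 2 - 1)) fun a c hac =>
    (torusXY_expectJ_cosDiff_layered_le_pow_interlayer (by omega) hp hz hX a c).trans
      (pow_le_pow_of_le_one hA0 hA1 hac)
  rwa [show layeredCoupling Kp Kz 2 = Kz by simp [layeredCoupling]] at h

/-- **NO c-AXIS PHASE STIFFNESS under the interlayer criterion.** If the layer's periodic susceptibility is bounded by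
`X` for all `L ≥ L₀` (at the base point `0`) and `K⊥ · X < 1`, then the interlayer helicity modulus of the stack vanishes
in the thermodynamic limit: `βΥ^{3D}_{L+1,e₃}(K∥, K∥, K⊥) → 0` (a cubic times a geometric sequence). In temperature units:
`J⊥ · χ₂(J∥/T) < T` ⇒ no interlayer phase coherence — the c-axis stiffness onset of the layered rotator is at most
`T_×(J∥, J⊥)`. [cite: FisherBarberJasnow1973, §II (helicity modulus); BricmontFontaineLandau1977, Appendix Thm A2; Lieb1980, eq. (23); AizenmanSimon1980LocalWard, Remark 4; LiuStanley1972, p. 272] -/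
theorem tendsto_torusXYDirStiffness_cAxis_of_interlayer_lt_one {Kp Kz X : ℝ} (hp : 0 ≤ Kp) (hz : 0 ≤ Kz)
    {L₀ : ℕ} (hX : ∀ (L : ℕ) [NeZero L], L₀ ≤ L →
      ∑ v : TorusSite 2 L, (torusXY 2 L).expectJ (fun _ => Kp) (cosDiff 0 v) ≤ X)
    (hA : Kz * X < 1) :
    Tendsto (fun L : ℕ => torusXYDirStiffness (L + 1) (layeredCoupling Kp Kz) 2) atTop (𝓝 0) := by
  haveI : NeZero (max L₀ 1) := ⟨by omega⟩
  have hK : ∀ m, 0 ≤ layeredCoupling Kp Kz m := fun m => layeredCoupling_nonneg hp hz m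
  have hX0 : 0 ≤ X := (torusXY_sum_expectJ_cosDiff_nonneg (L := max L₀ 1) hp 0).trans (hX _ (le_max_left _ _))
  set A : ℝ := Kz * X with hAdef
  have hA0 : 0 ≤ A := mul_nonneg hz hX0
  have hAabs : |A| < 1 := by rwa [abs_of_nonneg hA0]
  -- shift the index: `L + 1 = n + 3`
  rw [← tendsto_add_atTop_iff_nat 2]
  have hg : Tendsto (fun n : ℕ => 4 * Kz ^ 2 * 27 * (((n : ℝ) + 1) ^ 3 * A ^ n)) atTop (𝓝 0) := by
    simpa using (tendsto_succ_pow_mul_geom hAabs 3).const_mul (4 * Kz ^ 2 * 27)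
  refine squeeze_zero' (Eventually.of_forall fun n => torusXYDirStiffness_nonneg hK 2) ?_ hg
  filter_upwards [eventually_ge_atTop (max L₀ 1)] with n hn
  have hn0 : L₀ ≤ n := le_trans (le_max_left _ _) hn
  have hn1 : 1 ≤ n := le_trans (le_max_right _ _) hn
  have hXn : ∀ w : TorusSite 2 (n + 2 + 1),
      ∑ v, (torusXY 2 (n + 2 + 1)).expectJ (fun _ => Kp) (cosDiff w v) ≤ X := fun w => by
    rw [torusXY_sum_expectJ_cosDiff_eq_zero_base Kp w]; exact hX _ (by omega)
  have hb := abs_torusXYDirStiffness_cAxis_le_interlayer (L := n + 2 + 1) (by omega) hp hz hXn hA.le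
  refine (le_abs_self _).trans (hb.trans ?_)
  have h1 : ((Kz * X) ^ ((n + 2 + 1) / 2 - 1)) ^ 2 ≤ A ^ n := by
    rw [← hAdef, ← pow_mul]
    exact pow_le_pow_of_le_one hA0 hA.le (by omega)
  have h2 : (((n + 2 + 1 : ℕ) : ℝ)) ^ 3 ≤ 27 * (((n : ℝ)) + 1) ^ 3 := by
    have h' : (((n + 2 + 1 : ℕ) : ℝ)) ≤ 3 * ((n : ℝ) + 1) := by push_cast; linarith
    calc (((n + 2 + 1 : ℕ) : ℝ)) ^ 3 ≤ (3 * ((n : ℝ) + 1)) ^ 3 := pow_le_pow_left₀ (Nat.cast_nonneg _) h' 3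
      _ = 27 * ((n : ℝ) + 1) ^ 3 := by ring
  have hKz : 0 ≤ 4 * Kz ^ 2 := by positivity
  calc 4 * Kz ^ 2 * (((n + 2 + 1 : ℕ) : ℝ)) ^ 3 * ((Kz * X) ^ ((n + 2 + 1) / 2 - 1)) ^ 2
      ≤ 4 * Kz ^ 2 * (27 * ((n : ℝ) + 1) ^ 3) * A ^ n := by
        gcongr
    _ = 4 * Kz ^ 2 * 27 * (((n : ℝ) + 1) ^ 3 * A ^ n) := by ring

/-- **`Υ^{3D}_∞ = 0` along the c-axis under the interlayer criterion** (the typed liminf object of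
`LayeredPlaneRotatorStackStiffnessTransition.lean`). [cite: FisherBarberJasnow1973, §II eq. (2.5); Lieb1980, eq. (23); LiuStanley1972, p. 272] -/
theorem layeredStiffnessLiminf_cAxis_eq_zero_of_interlayer_lt_one {Kp Kz X : ℝ} (hp : 0 ≤ Kp) (hz : 0 ≤ Kz)
    {L₀ : ℕ} (hX : ∀ (L : ℕ) [NeZero L], L₀ ≤ L →
      ∑ v : TorusSite 2 L, (torusXY 2 L).expectJ (fun _ => Kp) (cosDiff 0 v) ≤ X)
    (hA : Kz * X < 1) :
    layeredStiffnessLiminf Kp Kz 2 = 0 :=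
  layeredStiffnessLiminf_eq_zero_of_tendsto (tendsto_torusXYDirStiffness_cAxis_of_interlayer_lt_one hp hz hX hA)

/-- **The c-axis stiffness transition coupling under the interlayer criterion.** Fix an anisotropy `Δ ≥ 0` and a
function `X(K)` bounding the layer's periodic susceptibility at coupling `K` (for all large `L`). If `Δ·K·X(K) < 1` for
every `0 ≤ K < c`, then `c ≤ K_Υ^{3D}(Δ, e₃)`: in temperature units, the c-axis stiffness onset temperature of the stack
with `J⊥ = Δ J∥` is at most `T_×(J∥, ΔJ∥)`. [cite: FisherBarberJasnow1973, §II eq. (2.5); Lieb1980, eq. (23); LiuStanley1972, p. 272 (T_c(ε))] -/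
theorem ofReal_le_layeredStiffnessCriticalCoupling_cAxis_of_interlayer {Δ c : ℝ} (hΔ : 0 ≤ Δ) {X : ℝ → ℝ}
    {L₀ : ℝ → ℕ}
    (hX : ∀ K : ℝ, 0 ≤ K → K < c → ∀ (L : ℕ) [NeZero L], L₀ K ≤ L →
      ∑ v : TorusSite 2 L, (torusXY 2 L).expectJ (fun _ => K) (cosDiff 0 v) ≤ X K)
    (hc : ∀ K : ℝ, 0 ≤ K → K < c → Δ * K * X K < 1) :
    ENNReal.ofReal c ≤ layeredStiffnessCriticalCoupling Δ 2 :=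
  ofReal_le_layeredStiffnessCriticalCoupling_of_forall_lt fun K hK hKc =>
    layeredStiffnessLiminf_cAxis_eq_zero_of_interlayer_lt_one hK (mul_nonneg hΔ hK) (hX K hK hKc) (hc K hK hKc)

/-! ### The computable form: ONE terminating two-dimensional box -/

/-- **The interlayer criterion with a COMPUTABLE layer input.** If Lieb's number of one two-dimensional box terminates,
`S_R(K∥) ≤ m < 1` (`R ≥ 1`), then the layer's periodic susceptibility is `≤ X_R(m) := ∑_{z ∈ ℤ²} m^{⌊‖z‖_∞/R⌋}` uniformly
in `L ≥ 2R + 2` (tree `sum_torusXY_expectJ_cosDiff_le_tsum`), hence for all `x, y`: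
`corr (K∥, K∥, K⊥) x y ≤ (K⊥ · X_R(m))^{d₂(x,y)}`. [cite: Lieb1980, Theorem 4 and p. 128 (boxes; finite algorithm); Simon1980CMP, Thm 1.3; LiuStanley1972, p. 272] -/
theorem corr_layered_le_pow_interlayer_box {Kp Kz m : ℝ} (hp : 0 ≤ Kp) (hz : 0 ≤ Kz) {R : ℕ} (hR : 1 ≤ R)
    (hL : 2 * R + 2 ≤ L) (hSm : nnBoxShellSum Kp 2 R ≤ m) (hm1 : m < 1) (x y : TorusSite 3 L) :
    corr (layeredCoupling Kp Kz) x y ≤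
      (Kz * ∑' z : Site 2, m ^ (Site.supNorm z / R)) ^ ((x - y) 2).valMinAbs.natAbs :=
  corr_layered_le_pow_interlayer (by omega) hp hz
    (fun w => sum_torusXY_expectJ_cosDiff_le_tsum hp hR hL hSm hm1 w) x y

/-- **No long-range order from one terminating 2D box and a weak interlayer coupling, explicitly**: with
`S_R(K∥) ≤ m < 1`, `X_R(m) = ∑_{z ∈ ℤ²} m^{⌊‖z‖_∞/R⌋}` and `A := K⊥ · X_R(m) < 1`, for every `L ≥ 2R + 2`:
`plateau_L(K∥, K∥, K⊥) ≤ (1 + A)/((1 − A) · L)`. The weak-interlayer window is EXPLICIT: `K⊥ < 1/X_R(m)`.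
[cite: Lieb1980, Theorem 4 and p. 128 (boxes; finite algorithm); Simon1980CMP, Thm 1.3; FriedliVelenikSMLS2017, (10.39)–(10.42); LiuStanley1972, p. 272] -/
theorem plateau_layered_le_interlayer_box {Kp Kz m : ℝ} (hp : 0 ≤ Kp) (hz : 0 ≤ Kz) {R : ℕ} (hR : 1 ≤ R)
    (hL : 2 * R + 2 ≤ L) (hSm : nnBoxShellSum Kp 2 R ≤ m) (hm1 : m < 1)
    (hA : Kz * ∑' z : Site 2, m ^ (Site.supNorm z / R) < 1) :
    plateau L (layeredCoupling Kp Kz) ≤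
      (1 + Kz * ∑' z : Site 2, m ^ (Site.supNorm z / R)) / ((1 - Kz * ∑' z : Site 2, m ^ (Site.supNorm z / R)) * L) :=
  plateau_layered_le_interlayer (by omega) hp hz (fun w => sum_torusXY_expectJ_cosDiff_le_tsum hp hR hL hSm hm1 w) hA

/-- **No c-axis stiffness from one terminating 2D box and a weak interlayer coupling**: `S_R(K∥) ≤ m < 1` and
`K⊥ · X_R(m) < 1` ⇒ `βΥ^{3D}_{L+1,e₃}(K∥, K∥, K⊥) → 0` and `Υ^{3D}_∞(K∥, K⊥, e₃) = 0`.
[cite: Lieb1980, Theorem 4 and p. 128 (boxes); FisherBarberJasnow1973, §II; LiuStanley1972, p. 272] -/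
theorem layeredStiffnessLiminf_cAxis_eq_zero_of_interlayer_box {Kp Kz m : ℝ} (hp : 0 ≤ Kp) (hz : 0 ≤ Kz) {R : ℕ}
    (hR : 1 ≤ R) (hSm : nnBoxShellSum Kp 2 R ≤ m) (hm1 : m < 1)
    (hA : Kz * ∑' z : Site 2, m ^ (Site.supNorm z / R) < 1) :
    Tendsto (fun L : ℕ => torusXYDirStiffness (L + 1) (layeredCoupling Kp Kz) 2) atTop (𝓝 0) ∧
      layeredStiffnessLiminf Kp Kz 2 = 0 := by
  have hX : ∀ (L : ℕ) [NeZero L], 2 * R + 2 ≤ L →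
      ∑ v : TorusSite 2 L, (torusXY 2 L).expectJ (fun _ => Kp) (cosDiff 0 v) ≤
        ∑' z : Site 2, m ^ (Site.supNorm z / R) := fun L _ hL => sum_torusXY_expectJ_cosDiff_le_tsum hp hR hL hSm hm1 0
  exact ⟨tendsto_torusXYDirStiffness_cAxis_of_interlayer_lt_one hp hz hX hA,
    layeredStiffnessLiminf_cAxis_eq_zero_of_interlayer_lt_one hp hz hX hA⟩

/-! ### Temperature form -/

/-- **`J⊥ · χ₂(T) < T` ⇒ no long-range order (temperature form).** For `J∥, J⊥ ≥ 0`, `T > 0`, `L ≥ 3` and a ceiling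
`χ` on the layer's periodic susceptibility at coupling `J∥/T` (every base point) with `J⊥ · χ < T`:

  `plateau_L(J∥/T, J∥/T, J⊥/T) ≤ (T + J⊥ χ) / ((T − J⊥ χ) · L)`.

So the long-range-order temperature of the layered rotator is at most `T_×(J∥, J⊥) = inf{T : J⊥ χ₂(J∥/T) < T}` — the
interlayer mean-field temperature as an UPPER BOUND; `T_× ↓ T_χ^{2D}(J∥)` (where `χ₂ = ∞`) as `J⊥ → 0`.
[cite: LiuStanley1972, p. 272 (T_c(ε) of the layers (J, J, εJ)); Lieb1980, eq. (23) and p. 128; Simon1980CMP, Thm 1.3; FriedliVelenikSMLS2017, (10.39)–(10.42)] -/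
theorem plateau_layered_le_of_interlayer_temperature (hL : 3 ≤ L) {Jp Jz T χ : ℝ} (hp : 0 ≤ Jp) (hz : 0 ≤ Jz)
    (hT : 0 < T)
    (hχ : ∀ w : TorusSite 2 L, ∑ v : TorusSite 2 L, (torusXY 2 L).expectJ (fun _ => Jp / T) (cosDiff w v) ≤ χ)
    (hA : Jz * χ < T) :
    plateau L (layeredCoupling (Jp / T) (Jz / T)) ≤ (T + Jz * χ) / ((T - Jz * χ) * L) := by
  have hA' : Jz / T * χ < 1 := by
    rw [div_mul_eq_mul_div, div_lt_one hT]; exact hA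
  have h := plateau_layered_le_interlayer hL (div_nonneg hp hT.le) (div_nonneg hz hT.le) hχ hA'
  have hL0 : (0 : ℝ) < (L : ℝ) := by exact_mod_cast (show 0 < L by omega)
  have hden : 0 < T - Jz * χ := by linarith
  refine h.trans (le_of_eq ?_)
  rw [div_mul_eq_mul_div]
  field_simp

end AnisotropicRotator

/-! ## §5 Free boundary conditions, infinite volume: across-layer decay with the layer's free susceptibility -/

namespace PlaneRotator

section Free

variable [MeasurableSpace Circle] [BorelSpace Circle]

open Literature.Barriers.CriticalPhenomena Literature.Barriers.CriticalPhenomena.LongRangeIsing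

omit [MeasurableSpace Circle] [BorelSpace Circle] in
/-- For two sites of `ℤ³` in the same layer the `ℓ¹` distance is the in-plane one. [cite: LiuStanley1972, p. 272 (layers (J, J, εJ)) — plumbing] -/
theorem l1Norm_sub_eq_planeProj_of_layer_eq {y z : Site 3} (h : y 2 = z 2) :
    l1Norm (y - z) = l1Norm (planeProj y - planeProj z) := by
  unfold l1Norm planeProj
  rw [Fin.sum_univ_three, Fin.sum_univ_two]
  simp [h]

omit [MeasurableSpace Circle] [BorelSpace Circle] in
/-- The in-plane projection is injective on each layer of `ℤ³`. [cite: LiuStanley1972, p. 272 (layers (J, J, εJ)) — plumbing] -/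
theorem eq_of_layer_eq_of_planeProj_eq {y z : Site 3} (h : y 2 = z 2) (hp : planeProj y = planeProj z) : y = z := by
  have h0 : y 0 = z 0 := by simpa [planeProj] using congrFun hp 0
  have h1 : y 1 = z 1 := by simpa [planeProj] using congrFun hp 1
  funext i
  fin_cases i
  · exact h0
  · exact h1
  · exact h

/-- **The in-plane system of a layer is dominated by the FREE infinite-volume layer**: for the layered XY model on a
finite `Λ ⊂ ℤ³` (free boundary conditions) and a site `a`, the susceptibility of the in-plane system of the layer of
`a` ALONE is at most the infinite-volume susceptibility of the two-dimensional model at `K = βJ∥`,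
`∑_{x ∈ Λ_{ℓ(a)}} ⟨cos(θ_a − θ_x)⟩^{2D}_{Λ_{ℓ(a)}} ≤ χ₂(βJ∥) := ∑_{w ∈ ℤ²} G^{free,∞}_{βJ∥}(0, w)` (when summable):
Griffiths–Ginibre in the volume, then translation invariance of `G^{free,∞}`.
[cite: Ginibre1970, Prop. 3 with Example 4 (plane rotators); Simon1980CMP, Thm 1.3 (χ = Σ_x ⟨σ₀σ_x⟩)] -/
theorem sum_twoPoint_inPlane_le_tsum_infTwoPoint {β Jp Jz : ℝ} (hβ : 0 ≤ β) (hp : 0 ≤ Jp) (hz : 0 ≤ Jz)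
    (Λ : Finset (Site 3)) (hG : Summable fun w : Site 2 => infTwoPoint (β * Jp) 2 0 w) (a : Λ) :
    ∑ x ∈ univ.filter (fun x : Λ => layer x = layer a),
      twoPoint (inPlane (layeredXYCoupling β Jp Jz Λ) (layer a)) a x ≤ ∑' w : Site 2, infTwoPoint (β * Jp) 2 0 w := by
  classical
  have hK : 0 ≤ β * Jp := mul_nonneg hβ hp
  -- the projected sites and the comparison map
  set Λ₂ : Finset (Site 2) := Λ.image planeProj with hΛ₂
  have hmem : ∀ y : Λ, planeProj (y : Site 3) ∈ Λ₂ := fun y => Finset.mem_image_of_mem _ y.2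
  let τ : Λ → Λ₂ := fun y => ⟨planeProj (y : Site 3), hmem y⟩
  set J := inPlane (layeredXYCoupling β Jp Jz Λ) (layer a) with hJ
  set A : Finset Λ := univ.filter (fun x : Λ => layer x = layer a) with hA
  have memA : ∀ x : Λ, x ∈ A ↔ (x : Site 3) 2 = (a : Site 3) 2 := fun x => by simp [hA, layer]
  have hJ0 : ∀ p, 0 ≤ J p := fun p => by
    simp only [hJ, inPlane]
    split_ifs
    · exact layeredXYCoupling_nonneg hβ hp hz Λ p
    · exact le_rfl
  have hJA : ∀ p, J p ≠ 0 → p.1 ∈ A ∧ p.2 ∈ A := by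
    intro p hp'
    simp only [hJ, inPlane] at hp'
    split_ifs at hp' with h
    · exact ⟨(memA p.1).2 h.1, (memA p.2).2 h.2⟩
    · exact absurd rfl hp'
  have hτ : Set.InjOn τ A := by
    intro y hy z hz hyz
    have h : planeProj (y : Site 3) = planeProj (z : Site 3) := congrArg Subtype.val hyz
    exact Subtype.ext (eq_of_layer_eq_of_planeProj_eq (((memA y).1 hy).trans ((memA z).1 hz).symm) h)
  have hK0 : ∀ q : Λ₂ × Λ₂, 0 ≤ nnXYCoupling (β * Jp) 2 Λ₂ q := fun q =>
    mul_nonneg (by positivity) (nnCoupling_nonneg _ _)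
  have hdom : ∀ y ∈ A, ∀ z ∈ A, J (y, z) ≤ nnXYCoupling (β * Jp) 2 Λ₂ (τ y, τ z) := by
    intro y hy z hz
    have hyz : (y : Site 3) 2 = (z : Site 3) 2 := ((memA y).1 hy).trans ((memA z).1 hz).symm
    have hy' : layer y = layer a := (memA y).1 hy
    have hz' : layer z = layer a := (memA z).1 hz
    simp only [hJ, inPlane, if_pos (And.intro hy' hz'), layeredXYCoupling, nnXYCoupling, LongRangeIsing.layeredCoupling,
      nnCoupling]
    rw [l1Norm_sub_eq_planeProj_of_layer_eq hyz]
    have h2 : ((y : Site 3) - (z : Site 3)) 2 = 0 := by simp [hyz]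
    simp only [h2, if_true]
    split_ifs <;> nlinarith
  have hGa : Summable fun w : Site 2 => infTwoPoint (β * Jp) 2 (planeProj (a : Site 3)) w :=
    (summable_infTwoPoint_base_iff hK _).2 hG
  calc ∑ x ∈ A, twoPoint J a x
      ≤ ∑ x ∈ A, twoPoint (nnXYCoupling (β * Jp) 2 Λ₂) (τ a) (τ x) :=
        Finset.sum_le_sum fun x hx => twoPoint_le_of_injOn hJ0 hJA τ hτ hK0 hdom ((memA a).2 rfl) hx
    _ = ∑ u ∈ A.image τ, twoPoint (nnXYCoupling (β * Jp) 2 Λ₂) (τ a) u := by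
        rw [Finset.sum_image fun y hy z hz hyz => hτ hy hz hyz]
    _ ≤ ∑ u : Λ₂, twoPoint (nnXYCoupling (β * Jp) 2 Λ₂) (τ a) u :=
        Finset.sum_le_sum_of_subset_of_nonneg (Finset.subset_univ _) fun u _ _ => twoPoint_nonneg hK0 _ _
    _ ≤ ∑ u : Λ₂, infTwoPoint (β * Jp) 2 (planeProj (a : Site 3)) (u : Site 2) :=
        Finset.sum_le_sum fun u _ => twoPoint_le_infTwoPoint hK Λ₂ (τ a) u
    _ = ∑ w ∈ Λ₂, infTwoPoint (β * Jp) 2 (planeProj (a : Site 3)) w :=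
        Finset.sum_coe_sort Λ₂ (fun w => infTwoPoint (β * Jp) 2 (planeProj (a : Site 3)) w)
    _ ≤ ∑' w : Site 2, infTwoPoint (β * Jp) 2 (planeProj (a : Site 3)) w :=
        hGa.sum_le_tsum _ fun w _ => infTwoPoint_nonneg hK _ _
    _ = ∑' w : Site 2, infTwoPoint (β * Jp) 2 0 w := tsum_infTwoPoint_base hK _

/-- **Layer decoupling with the free layer susceptibility (every finite volume).** For `β, J∥, J⊥ ≥ 0`, every finite
`Λ ⊂ ℤ³` and `a, c ∈ Λ`: if `χ₂ := ∑_{w ∈ ℤ²} G^{free,∞}_{βJ∥}(0, w) < ∞` then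
`⟨cos(θ_a − θ_c)⟩_{Λ,β} ≤ (β J⊥ · χ₂)^{|ℓ(a) − ℓ(c)|}` — mod-1's `twoPoint_layered_le_pow_interlayer'` with the layer
input discharged by the previous theorem. [cite: Lieb1980, eq. (23); Rivasseau1980, Theorem; AizenmanSimon1980LocalWard, Thm 3.2 and Remark 4; LiuStanley1972, p. 272 (T_c(ε) of the layers (J, J, εJ))] -/
theorem twoPoint_layered_le_pow_interlayer_tsum {β Jp Jz : ℝ} (hβ : 0 ≤ β) (hp : 0 ≤ Jp) (hz : 0 ≤ Jz)
    (Λ : Finset (Site 3)) (hG : Summable fun w : Site 2 => infTwoPoint (β * Jp) 2 0 w) (a c : Λ) :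
    twoPoint (layeredXYCoupling β Jp Jz Λ) a c ≤
      (β * Jz * ∑' w : Site 2, infTwoPoint (β * Jp) 2 0 w) ^ (layer a - layer c).natAbs :=
  twoPoint_layered_le_pow_interlayer' hβ hp hz Λ (fun a' => sum_twoPoint_inPlane_le_tsum_infTwoPoint hβ hp hz Λ hG a') a c

/-- **The interlayer criterion in infinite volume (free boundary conditions).** For `β, J∥, J⊥ ≥ 0` with a summable
free layer two-point function, `χ₂(βJ∥) = ∑_{w ∈ ℤ²} G^{free,∞}_{βJ∥}(0, w)`:

  `G^{3D,free,∞}_{β;J∥,J⊥}(x, y) ≤ (β J⊥ · χ₂(βJ∥))^{|x₂ − y₂|}`  for all `x, y ∈ ℤ³`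

— across-layer exponential decay with an interlayer mass of at least `log(T/(J⊥ χ₂(J∥/T)))` per layer as soon as
`J⊥ · χ₂(J∥/T) < T`. [cite: Lieb1980, eq. (23); AizenmanSimon1980LocalWard, Remark 4 (mass gap by iteration); Simon1980CMP, Thm 1.3; LiuStanley1972, p. 272] -/
theorem infTwoPointLayered_le_pow_interlayer {β Jp Jz : ℝ} (hβ : 0 ≤ β) (hp : 0 ≤ Jp) (hz : 0 ≤ Jz)
    (hG : Summable fun w : Site 2 => infTwoPoint (β * Jp) 2 0 w) (x y : Site 3) :
    infTwoPointLayered β Jp Jz x y ≤ (β * Jz * ∑' w : Site 2, infTwoPoint (β * Jp) 2 0 w) ^ (x 2 - y 2).natAbs := by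
  have hA0 : 0 ≤ β * Jz * ∑' w : Site 2, infTwoPoint (β * Jp) 2 0 w :=
    mul_nonneg (mul_nonneg hβ hz) (tsum_nonneg fun w => infTwoPoint_nonneg (mul_nonneg hβ hp) _ _)
  refine infTwoPointLayered_le_of_forall_box fun n => ?_
  by_cases h : x ∈ box 3 n ∧ y ∈ box 3 n
  · rw [volTwoPointLayered_of_mem β Jp Jz h.1 h.2]
    exact twoPoint_layered_le_pow_interlayer_tsum hβ hp hz _ hG ⟨x, h.1⟩ ⟨y, h.2⟩
  · unfold volTwoPointLayered
    rw [dif_neg h]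
    exact pow_nonneg hA0 _

end Free

end PlaneRotator

end Literature.Probability.LatticeModels

end
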